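import Summits.Ventures.Crystal3D.Theorems.StickyWulffConstantNoReconstructionGainConeBand
import Summits.Ventures.Crystal3D.Theorems.StickyWulffConstantNoReconstructionGainLayerCover
import Literature.MathematicalPhysics.StatisticalMechanics.BarlowCoordination
import HarnessLib

/-!
# Geometry of the `(111)` slab sample for the low-coordination adhesion rung

HONEST FRAMING. Part of the venture `Summits/Ventures/Crystal3D` (cell `crystal3d-full`), helper
`--supports` the crux `NoReconstructionGain` (stmt-Ventures-19144, route
`route-Ventures-StickyWulffConstant`; the WK line of p1 gen 12, rung `LowCoordAdhesion111 9`).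
The slab sample at `ν = e₃` with `R = 4`: `P` = all sites of `Λ₀ = fccStacking 1 √(2/3)` with
`−8 ≤ z ≤ −4` and lateral radius `≤ ρ`, i.e. the five complete hexagonal layers `k = −9, …, −5`
(heights `k h`, `h = √(2/3)`) cut to the disc.  With the SLAB POTENTIAL
`Φ(y) = max (y₂ + 5h, −9h − y₂, 0)` (distance to the slab of the sample along the axis; convex,
`1`-Lipschitz, `0` on the sample):

* `card_steepPartners_le_three` — a ball `q` of a unit packing `X` has at most THREE partners `x`
  with `Φ x − Φ q ≤ −h` (above the slab these have `(x − q)₂ ≤ −h`: cone lemma; inside nothing;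
  below symmetric).
* `rim_of_lowPotential_partner` — if `q ∈ X \ P` with `Φ q < h` touches `p ∈ P`, then `p` is a
  RIM site (lateral radius `> ρ − 2`): over the disc interior the covering radius `1/√3` of each
  layer (`…LayerCover`) forces every non-sample ball to sit in a hollow position at height `≥ h`
  above the top layer (or below the bottom layer), and forbids any inside the slab.
* The rim count (`card_rim_le`, `≤ 75 π ρ`) is in `…LowCoordRim.lean`.

WHAT THIS IS NOT: the rung itself (`…LowCoordAdhesion.lean`); rung F-C1 not moved.
-/

noncomputable section

namespace Summit.Ventures.Crystal3D.Theorems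

open Summit.Ventures.Crystal3D Finset Real
open Literature.MathematicalPhysics.StatisticalMechanics (barlowPos barlowStacking fccStacking
  constHagg isHaggSeq_const haggLabel_const barlowPos_mem barlowPos_apply_zero barlowPos_apply_one
  barlowPos_apply_two le_dist_barlowPos_of_ideal)
open scoped InnerProductSpace

/-! ## Numerical facts about `h = √(2/3)` -/

/-- `h = √(2/3)` satisfies `h² = 2/3`, `4/5 ≤ h ≤ 8/9`. -/
theorem sqrt_two_thirds_bounds :
    Real.sqrt (2 / 3) ^ 2 = 2 / 3 ∧ (4 : ℝ) / 5 ≤ Real.sqrt (2 / 3) ∧ Real.sqrt (2 / 3) ≤ 8 / 9 := by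
  have h2 : Real.sqrt (2 / 3) ^ 2 = 2 / 3 := Real.sq_sqrt (by norm_num)
  have h0 : 0 ≤ Real.sqrt (2 / 3) := Real.sqrt_nonneg _
  refine ⟨h2, ?_, ?_⟩
  · exact (pow_le_pow_iff_left₀ (by norm_num) h0 two_ne_zero).1 (by rw [h2]; norm_num)
  · exact (pow_le_pow_iff_left₀ h0 (by norm_num) two_ne_zero).1 (by rw [h2]; norm_num)

/-- Planar triangle inequality in coordinates: `|a| ≤ r`, `|d| ≤ s` give `|a + d| ≤ r + s`. -/
theorem planar_sq_add_sq_le (a₀ a₁ d₀ d₁ r s : ℝ) (hr : 0 ≤ r) (hs : 0 ≤ s)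
    (ha : a₀ ^ 2 + a₁ ^ 2 ≤ r ^ 2) (hd : d₀ ^ 2 + d₁ ^ 2 ≤ s ^ 2) :
    (a₀ + d₀) ^ 2 + (a₁ + d₁) ^ 2 ≤ (r + s) ^ 2 := by
  -- Cauchy–Schwarz in the plane
  have hcs : (a₀ * d₀ + a₁ * d₁) ^ 2 ≤ (a₀ ^ 2 + a₁ ^ 2) * (d₀ ^ 2 + d₁ ^ 2) := by
    nlinarith [sq_nonneg (a₀ * d₁ - a₁ * d₀)]
  have hcs' : (a₀ * d₀ + a₁ * d₁) ^ 2 ≤ (r * s) ^ 2 := by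
    rw [mul_pow]
    exact hcs.trans (mul_le_mul ha hd (by positivity) (by positivity))
  have hle : a₀ * d₀ + a₁ * d₁ ≤ r * s :=
    le_trans (le_abs_self _) ((pow_le_pow_iff_left₀ (abs_nonneg _) (by positivity)
      two_ne_zero).1 (by rw [sq_abs]; exact hcs'))
  nlinarith

/-! ## The slab potential and steep partners -/

/-- **At most three steep partners.**  `X` a unit packing, `q` any point,
`Φ(y) = max (y₂ + 5h) (max (−9h − y₂) 0)` the slab potential (`h = √(2/3)`): at most three
`x ∈ X` touch `q` with `Φ x − Φ q ≤ −h`. -/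
theorem card_steepPartners_le_three (X : Finset (EuclideanSpace ℝ (Fin 3)))
    (hX : ∀ p ∈ X, ∀ q ∈ X, p ≠ q → 1 ≤ dist p q) (q : EuclideanSpace ℝ (Fin 3))
    (Φ : EuclideanSpace ℝ (Fin 3) → ℝ)
    (hΦ : ∀ y, Φ y = max (y 2 + 5 * Real.sqrt (2 / 3)) (max (-(9 * Real.sqrt (2 / 3)) - y 2) 0)) :
    (X.filter fun x => dist q x = 1 ∧ Φ x - Φ q ≤ -Real.sqrt (2 / 3)).card ≤ 3 := by
  classical
  obtain ⟨hh2, hh45, _⟩ := sqrt_two_thirds_bounds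
  set h : ℝ := Real.sqrt (2 / 3) with hhdef
  have hh0 : 0 ≤ h := Real.sqrt_nonneg _
  have hh58 : (5 : ℝ) / 8 < h ^ 2 := by rw [hh2]; norm_num
  set A := X.filter fun x => dist q x = 1 ∧ Φ x - Φ q ≤ -h with hA
  have hΦlo : ∀ y, y 2 + 5 * h ≤ Φ y := fun y => by rw [hΦ]; exact le_max_left _ _
  have hΦlo' : ∀ y, -(9 * h) - y 2 ≤ Φ y := fun y => by
    rw [hΦ]; exact le_trans (le_max_left _ _) (le_max_right _ _)
  have hΦ0 : ∀ y, 0 ≤ Φ y := fun y => by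
    rw [hΦ]; exact le_trans (le_max_right _ _) (le_max_right _ _)
  -- the unit vectors `x - q`
  have hinj : Set.InjOn (fun x : EuclideanSpace ℝ (Fin 3) => x - q) ↑A :=
    fun x _ y _ hxy => sub_left_injective hxy
  have hmemA : ∀ x ∈ A, x ∈ X ∧ dist q x = 1 ∧ Φ x - Φ q ≤ -h := fun x hx => by
    rw [hA, mem_filter] at hx; exact ⟨hx.1, hx.2.1, hx.2.2⟩
  have hunit : ∀ u ∈ A.image (fun x => x - q), ‖u‖ = 1 := by
    intro u hu
    obtain ⟨x, hx, rfl⟩ := mem_image.1 hu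
    rw [← dist_eq_norm, dist_comm]; exact (hmemA x hx).2.1
  have hsep : ∀ u ∈ A.image (fun x => x - q), ∀ w ∈ A.image (fun x => x - q), u ≠ w →
      ⟪u, w⟫_ℝ ≤ 1 / 2 := by
    intro u hu w hw huw
    obtain ⟨x, hx, rfl⟩ := mem_image.1 hu
    obtain ⟨y, hy, rfl⟩ := mem_image.1 hw
    refine inner_le_half_of_one_le_dist (hunit _ hu) (hunit _ hw) ?_
    rw [dist_eq_norm, sub_sub_sub_cancel_right, ← dist_eq_norm]
    exact hX x (hmemA x hx).1 y (hmemA y hy).1 fun hxy => huw (by rw [hxy])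
  rw [← card_image_of_injOn hinj]
  by_cases hup : -(5 * h) < q 2
  · -- above the slab: steep partners point into the lower cone
    have hΦq : Φ q = q 2 + 5 * h := by
      rw [hΦ, max_eq_left]
      exact max_le (by linarith) (by linarith)
    refine card_negCone_le_three h hh0 hh58 hunit (fun u hu => ?_) hsep
    obtain ⟨x, hx, rfl⟩ := mem_image.1 hu
    have h1 := (hmemA x hx).2.2
    rw [hΦq] at h1
    rw [PiLp.sub_apply]
    linarith [hΦlo x]
  by_cases hdown : q 2 < -(9 * h)
  · -- below the slab: steep partners point into the upper cone
    have hΦq : Φ q = -(9 * h) - q 2 := by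
      rw [hΦ, max_eq_right_of_lt (by
        calc q 2 + 5 * h < -(9 * h) - q 2 := by linarith
          _ ≤ max (-(9 * h) - q 2) 0 := le_max_left _ _), max_eq_left (by linarith)]
    refine card_cone_le_three h hh0 hh58 hunit (fun u hu => ?_) hsep
    obtain ⟨x, hx, rfl⟩ := mem_image.1 hu
    have h1 := (hmemA x hx).2.2
    rw [hΦq] at h1
    rw [PiLp.sub_apply]
    linarith [hΦlo' x]
  · -- inside the slab: no steep partners at all
    have hΦq : Φ q = 0 := by
      rw [hΦ, max_eq_right (by
        calc q 2 + 5 * h ≤ 0 := by linarith [not_lt.1 hup]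
          _ ≤ max (-(9 * h) - q 2) 0 := le_max_right _ _), max_eq_right (by linarith [not_lt.1 hdown])]
    have hAe : A.image (fun x => x - q) = ∅ := by
      rw [image_eq_empty, eq_empty_iff_forall_notMem]
      intro x hx
      have h1 := (hmemA x hx).2.2
      rw [hΦq, sub_zero] at h1
      linarith [hΦ0 x, hh45]
    rw [hAe, card_empty]; norm_num

/-! ## Bad cross bonds sit at the rim -/

/-- **Low-potential partners touch only rim sites.**  `P` = the slab sample (`R = 4`: all sites of
`fccStacking 1 √(2/3)` with `−8 ≤ z ≤ −4` and lateral radius `≤ ρ`, `ρ ≥ 4`) inside a unit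
packing `X`; if `q ∈ X \ P` with `Φ q < h` touches a point `p` (e.g. `p ∈ P`), then `p` has
lateral radius `> ρ − 2`.
(Over the disc interior, a non-sample ball above the top layer sits at height `≥ h` by the
covering radius `1/√3` of the layer; inside the slab there is no room; below is symmetric.) -/
theorem rim_of_lowPotential_partner (ρ : ℝ) (hρ : 4 ≤ ρ) (X P : Finset (EuclideanSpace ℝ (Fin 3)))
    (hX : ∀ p ∈ X, ∀ q ∈ X, p ≠ q → 1 ≤ dist p q) (hPX : P ⊆ X)
    (hP : ∀ p, p ∈ P ↔ (p ∈ fccStacking 1 (Real.sqrt (2 / 3)) ∧ -8 ≤ p 2 ∧ p 2 ≤ -4 ∧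
      p 0 ^ 2 + p 1 ^ 2 ≤ ρ ^ 2))
    (Φ : EuclideanSpace ℝ (Fin 3) → ℝ)
    (hΦ : ∀ y, Φ y = max (y 2 + 5 * Real.sqrt (2 / 3)) (max (-(9 * Real.sqrt (2 / 3)) - y 2) 0))
    (p q : EuclideanSpace ℝ (Fin 3)) (hqX : q ∈ X) (hqP : q ∉ P)
    (hpq : dist p q = 1) (hΦq : Φ q < Real.sqrt (2 / 3)) :
    (ρ - 2) ^ 2 < p 0 ^ 2 + p 1 ^ 2 := by
  obtain ⟨hh2, hh45, hh89⟩ := sqrt_two_thirds_bounds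
  set h : ℝ := Real.sqrt (2 / 3) with hhdef
  have hhpos : 0 < h := by linarith
  by_contra hle
  have hle := not_lt.1 hle
  -- lateral radius of `q` is at most `ρ - 1`
  have hdq : (q 0 - p 0) ^ 2 + (q 1 - p 1) ^ 2 ≤ 1 ^ 2 := by
    have hd : dist q p ^ 2 = (q 0 - p 0) ^ 2 + (q 1 - p 1) ^ 2 + (q 2 - p 2) ^ 2 := by
      rw [EuclideanSpace.dist_eq, Real.sq_sqrt (Finset.sum_nonneg fun _ _ => sq_nonneg _),
        Fin.sum_univ_three]
      simp only [Real.dist_eq, sq_abs]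
    rw [dist_comm, hpq] at hd
    nlinarith [sq_nonneg (q 2 - p 2)]
  have hlatq : q 0 ^ 2 + q 1 ^ 2 ≤ (ρ - 1) ^ 2 := by
    have := planar_sq_add_sq_le (p 0) (p 1) (q 0 - p 0) (q 1 - p 1) (ρ - 2) 1 (by linarith)
      zero_le_one hle hdq
    have e0 : p 0 + (q 0 - p 0) = q 0 := by ring
    have e1 : p 1 + (q 1 - p 1) = q 1 := by ring
    rw [e0, e1, show ρ - 2 + 1 = ρ - 1 by ring] at this
    exact this
  -- a covering site of layer `k` within lateral `ρ`, at height in `[-8,-4]`, is a sample ball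
  have hsite : ∀ k i j : ℤ, -9 ≤ k → k ≤ -5 →
      (q 0 - barlowPos 1 h constHagg k i j 0) ^ 2 + (q 1 - barlowPos 1 h constHagg k i j 1) ^ 2
        ≤ 1 / 3 → barlowPos 1 h constHagg k i j ∈ P := by
    intro k i j hk1 hk2 hcov
    rw [hP]
    refine ⟨barlowPos_mem _ _ _, ?_, ?_, ?_⟩
    · rw [barlowPos_apply_two]
      have : (-9 : ℝ) ≤ k := by exact_mod_cast hk1
      nlinarith
    · rw [barlowPos_apply_two]
      have : (k : ℝ) ≤ -5 := by exact_mod_cast hk2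
      nlinarith
    · have := planar_sq_add_sq_le (q 0) (q 1) (barlowPos 1 h constHagg k i j 0 - q 0)
        (barlowPos 1 h constHagg k i j 1 - q 1) (ρ - 1) 1 (by linarith) zero_le_one hlatq (by
          have e : (barlowPos 1 h constHagg k i j 0 - q 0) ^ 2 +
              (barlowPos 1 h constHagg k i j 1 - q 1) ^ 2 =
              (q 0 - barlowPos 1 h constHagg k i j 0) ^ 2 +
                (q 1 - barlowPos 1 h constHagg k i j 1) ^ 2 := by ring
          rw [e]; linarith)
      have e0 : q 0 + (barlowPos 1 h constHagg k i j 0 - q 0) = barlowPos 1 h constHagg k i j 0 := by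
        ring
      have e1 : q 1 + (barlowPos 1 h constHagg k i j 1 - q 1) = barlowPos 1 h constHagg k i j 1 := by
        ring
      rw [e0, e1, show ρ - 1 + 1 = ρ by ring] at this
      exact this
  -- distance from `q` to a covering site, squared
  have hdist : ∀ k i j : ℤ, dist q (barlowPos 1 h constHagg k i j) ^ 2 =
      (q 0 - barlowPos 1 h constHagg k i j 0) ^ 2 + (q 1 - barlowPos 1 h constHagg k i j 1) ^ 2 +
      (q 2 - (k : ℝ) * h) ^ 2 := by
    intro k i j
    rw [EuclideanSpace.dist_eq, Real.sq_sqrt (Finset.sum_nonneg fun _ _ => sq_nonneg _),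
      Fin.sum_univ_three]
    simp only [Real.dist_eq, sq_abs, barlowPos_apply_two]
  -- a sample ball is at distance `≥ 1` from `q`
  have hfar : ∀ p' ∈ P, 1 ≤ dist q p' := fun p' hp' =>
    hX q hqX p' (hPX hp') fun hqp => hqP (hqp ▸ hp')
  by_cases hup : -(5 * h) < q 2
  · -- above the top layer `k = -5`: hollow position, `Φ q ≥ h`
    obtain ⟨i, j, hcov⟩ := exists_fccSite_planar_sq_le_third (q 0) (q 1) (-5)
    have hmem := hsite (-5) i j (by norm_num) (by norm_num) hcov
    have hsq := hollow_height_sq q (-5) i j hcov (hfar _ hmem)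
    push_cast at hsq
    have hpos : 0 < q 2 + 5 * h := by linarith
    have hge : h ≤ q 2 + 5 * h := by
      by_contra hlt
      have hlt := not_le.1 hlt
      nlinarith [hh2]
    have : h ≤ Φ q := le_trans hge (by rw [hΦ]; exact le_max_left _ _)
    linarith
  by_cases hdown : q 2 < -(9 * h)
  · -- below the bottom layer `k = -9`
    obtain ⟨i, j, hcov⟩ := exists_fccSite_planar_sq_le_third (q 0) (q 1) (-9)
    have hmem := hsite (-9) i j (by norm_num) (by norm_num) hcov
    have hsq := hollow_height_sq q (-9) i j hcov (hfar _ hmem)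
    push_cast at hsq
    have hpos : 0 < -(9 * h) - q 2 := by linarith
    have hge : h ≤ -(9 * h) - q 2 := by
      by_contra hlt
      have hlt := not_le.1 hlt
      nlinarith [hh2]
    have : h ≤ Φ q := le_trans hge (by
      rw [hΦ]; exact le_trans (le_max_left _ _) (le_max_right _ _))
    linarith
  · -- inside the slab: the nearest layer is within `h/2`, its covering site within distance `< 1`
    have hup' := not_lt.1 hup
    have hdown' := not_lt.1 hdown
    set k : ℤ := ⌊q 2 / h + 1 / 2⌋ with hk
    have hk1 : (k : ℝ) ≤ q 2 / h + 1 / 2 := Int.floor_le _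
    have hk2 : q 2 / h + 1 / 2 < (k : ℝ) + 1 := Int.lt_floor_add_one _
    have hqh : q 2 / h * h = q 2 := div_mul_cancel₀ _ hhpos.ne'
    have hkh : |q 2 - (k : ℝ) * h| ≤ h / 2 := by
      rw [abs_le]; constructor
      · have := mul_le_mul_of_nonneg_right hk1 hhpos.le
        rw [add_mul, hqh] at this; linarith
      · have := mul_le_mul_of_nonneg_right hk2.le hhpos.le
        rw [add_mul, add_mul, hqh] at this; linarith
    have hklo : -9 ≤ k := by
      have h1 : (-9 : ℝ) ≤ q 2 / h := by rw [le_div_iff₀ hhpos]; linarith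
      have h2 : (-9 : ℤ) ≤ ⌊q 2 / h + 1 / 2⌋ := Int.le_floor.2 (by push_cast; linarith)
      rw [hk]; exact h2
    have hkhi : k ≤ -5 := by
      have h1 : q 2 / h ≤ -5 := by rw [div_le_iff₀ hhpos]; linarith
      have h2 : ⌊q 2 / h + 1 / 2⌋ < (-5 : ℤ) + 1 := Int.floor_lt.2 (by push_cast; linarith)
      rw [hk]; omega
    obtain ⟨i, j, hcov⟩ := exists_fccSite_planar_sq_le_third (q 0) (q 1) k
    have hmem := hsite k i j hklo hkhi hcov
    have h1 := hfar _ hmem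
    have hd2 := hdist k i j
    have hzk : (q 2 - (k : ℝ) * h) ^ 2 ≤ (h / 2) ^ 2 := by
      rw [← sq_abs]; exact pow_le_pow_left₀ (abs_nonneg _) hkh 2
    have hlt1 : dist q (barlowPos 1 h constHagg k i j) ^ 2 < 1 := by
      have e : (h / 2) ^ 2 = 1 / 6 := by rw [div_pow, hh2]; norm_num
      rw [hd2]; linarith [hzk.trans_eq e]
    have hge1 : 1 ≤ dist q (barlowPos 1 h constHagg k i j) ^ 2 := by
      have h0 : 0 ≤ dist q (barlowPos 1 h constHagg k i j) := dist_nonneg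
      nlinarith
    linarith

end Summit.Ventures.Crystal3D.Theorems

end
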